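import Literature.Probability.LatticeModels.MedialCycleTurning
import Literature.Probability.LatticeModels.FKPrimitive
import HarnessLib

/-!
# The winding of the FK interface at a free-arc dart is deterministic; `F(e) = P(e ∈ γ)` there

Topic `Literature/Probability/LatticeModels`; part of the discharge programme for the named fact
`fkIsing_rsw` (DCHN 2011 Thm. 1 / DCS 2012 Thm. 3.16), second instalment (after
`FKFreeArcPassage.lean`) of the *upper* comparability in Duminil-Copin–Hongler–Nolin's Lemma 12:
"since the edge `e` is along the free arc, the winding `W_γ(e_a, e)` of the exploration path at
`e` is constant … This implies that `P(e ∈ γ) = |F(e)|`" (p. 12 of arXiv:0912.4253; Duminil-Copin–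
Smirnov 2012, proof of Prop. 7.8). Theorems, plus the definitions of the closing polygon; no named
fact.

* `FreeArcPhase.turnCount_eq_zero_or_eight`: for the start corner `c₀ L = ((L, 0), 3)` and the
  free-arc dart `qX X = ((X, 0), 3)` (both pointing down to a free arc lying below the row
  `{x₁ = 0}`), if the dart is the `j`-th corner of the orbit of the start corner, the orbit is
  injective up to `j`, its left vertices have nonnegative height and the edge below `(X, 0)` is
  closed (`FreeArcPhase.Hyp`), then `turnCount β (c₀ L) j ∈ {0, 8}`.
* `FreeArcPhase.dartObs_qX_eq`: for admissible Dobrushin data whose start corner is `c₀ L`, whose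
  sites off the free arc have nonnegative height, with `(X, -1)` on the free arc and the face of
  `qX X` inner, the dart observable at `qX X` IS the passage probability:
  `F(qX X) = P(cSrc (qX X) ∈ γ)` (a nonnegative real), hence `|F|² = P(e ∈ γ)²`
  (`FreeArcPhase.dartFlux_qX_eq`).

## The proof (Hopf's Umlaufsatz for the closed-up interface prefix)

The perturbed polygon of the interface prefix (`pieceVert`, `MedialCycleTurning.lean`: the shifted
points `sPt (orb 0), tPt (orb 0), …, tPt (orb (j-1)), sPt (orb j) = sPt qX = (X + 1/8, -3/8)`) is
closed below the free arc through `D₁ = (X + 1/8, -1/2)`, `D₂ = (L + 1/8, -1/2)` back to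
`sPt c₀ = (L + 1/8, -3/8)` (`FreeArcPhase.cyc`). It is a simple closed polygon
(`FreeArcPhase.isSimplePolygon_cyc`): non-adjacent prefix pieces are disjoint as in
`pieceVert_disjoint` (injectivity of the prefix); every prefix piece lies at height `≥ -3/8`
(vertices at height `≥ 0`, offsets `I^k dS`, `I^k dT`), the bottom edge at height `-1/2`; the two
vertical closing edges meet the prefix only at `sPt qX`, resp. `sPt c₀`, which lie only on the
adjacent piece (`eq_of_mem_dart_dart`, `orb_eq_of_mem_dart_conn`, `dart_inter_conn_subset`). Its
exterior angles are: `(π/2) · turnSign` per interior turn (`arg_at_tPt`, `arg_at_sPt`), `π/4` at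
the last target point (a vertex turn into the dart), `-π/2` at `sPt qX`, `D₁`, `D₂`, and `-π/4`
at `sPt c₀`; total `(π/2) · turnCount - 2π` (`sum_extAngle_cyc`). By Hopf's Umlaufsatz
(`IsSimplePolygon.sum_extAngle_eq`, `PolygonUmlaufsatz.lean`, proved in the tree) the total is
`±2π`, so `turnCount ∈ {0, 8}` and the phase `quarterPhase (turnCount) = 1`.

## References

* H. Duminil-Copin, C. Hongler, P. Nolin, *Connection probabilities and RSW-type bounds for the
  two-dimensional FK Ising model*, Comm. Pure Appl. Math. 64 (2011) 1165–1198 (arXiv:0912.4253),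
  §4, Lemma 12. [DuminilCopinHonglerNolin2011]
* H. Duminil-Copin, S. Smirnov, *Conformal invariance of lattice models*, Clay Math. Proc. 15
  (2012), Prop. 7.8. [DuminilCopinSmirnov2012Clay]
* H. Hopf, *Über die Drehung der Tangenten und Sehnen ebener Kurven*, Compositio Math. 2 (1935),
  Satz I. [Hopf1935]
* S. Smirnov, *Conformal invariance in random cluster models I*, Ann. Math. 172 (2010), §4
  (the observable, Lemma 4.1, Remark 4.2). [Smirnov2010]
-/

noncomputable section

open Complex Set Finset Literature.Topology.PlaneTopology

namespace Literature.Probability.LatticeModels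

namespace FreeArcPhase

/-! ### Imaginary parts of the shifted points -/

/-- The imaginary parts of the four rotations of `dS`. [folklore] -/
theorem im_I_pow_mul_dS (k : Fin 4) : -(3 / 8 : ℝ) ≤ (I ^ (k : ℕ) * dS).im := by
  fin_cases k <;> norm_num [dS, pow_succ]

/-- The imaginary parts of the four rotations of `dT`. [folklore] -/
theorem im_I_pow_mul_dT (k : Fin 4) : -(3 / 8 : ℝ) ≤ (I ^ (k : ℕ) * dT).im := by
  fin_cases k <;> norm_num [dT, pow_succ]

/-- A source point lies at most `3/8` below its vertex. [folklore] -/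
theorem im_sPt_ge (p : Site 2 × Fin 4) : (p.1 1 : ℝ) - 3 / 8 ≤ (sPt p).im := by
  rw [sPt, Complex.add_im, Site.toComplex_im]
  linarith [im_I_pow_mul_dS p.2]

/-- A target point lies at most `3/8` below its vertex. [folklore] -/
theorem im_tPt_ge (p : Site 2 × Fin 4) : (p.1 1 : ℝ) - 3 / 8 ≤ (tPt p).im := by
  rw [tPt, Complex.add_im, Site.toComplex_im]
  linarith [im_I_pow_mul_dT p.2]

/-- Imaginary parts on a segment are bounded below by the smaller endpoint value. [folklore] -/
theorem im_ge_of_mem_segment {a b z : ℂ} {c : ℝ} (ha : c ≤ a.im) (hb : c ≤ b.im) (hz : z ∈ segment ℝ a b) : c ≤ z.im := by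
  rw [segment_eq_image'] at hz
  obtain ⟨t, ⟨ht0, ht1⟩, rfl⟩ := hz
  simp only [Complex.add_im, Complex.real_smul, Complex.mul_im, Complex.ofReal_re, Complex.ofReal_im, Complex.sub_im,
    zero_mul, add_zero]
  nlinarith

/-! ### The closed polygon: the interface prefix up to a free-arc dart, closed below the free arc -/

section Setup

variable (β : Percolation.BondConfig (Site 2)) (L X : ℤ) (j : ℕ)

/-- The start corner at the left end `(L, 0)` of the bottom free arc, source edge pointing down.
[cite: Smirnov2001, §2] -/
def c₀ : Site 2 × Fin 4 := (![L, 0], 3)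

/-- The free-arc dart at `(X, 0)`, source edge pointing down. [cite: Smirnov2001, §2] -/
def qX : Site 2 × Fin 4 := (![X, 0], 3)

/-- The first closing vertex, below `sPt qX`: `(X + 1/8, -1/2)`. [folklore] -/
def D₁ : ℂ := ⟨X + 1 / 8, -(1 / 2)⟩

/-- The second closing vertex, below `sPt c₀`: `(L + 1/8, -1/2)`. [folklore] -/
def D₂ : ℂ := ⟨L + 1 / 8, -(1 / 2)⟩

/-- The vertices of the closed polygon: the `2j + 1` shifted points of the interface prefix
`sPt (orb 0), tPt (orb 0), …, tPt (orb (j-1)), sPt (orb j)`, then `D₁`, `D₂`. [folklore] -/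
def vert (i : ℕ) : ℂ :=
  if i ≤ 2 * j then pieceVert β (c₀ L) i else if i = 2 * j + 1 then D₁ X else D₂ L

/-- The vertices as a `(2j+3)`-periodic `ℤ`-indexed sequence. [folklore] -/
def cyc (i : ℤ) : ℂ := vert β L X j ((i % ((2 * j + 3 : ℕ) : ℤ)).toNat)

variable {β L X j}

/-- `sPt` of the start corner. [folklore] -/
theorem sPt_c₀ : sPt (c₀ L) = ⟨L + 1 / 8, -(3 / 8)⟩ := by
  apply Complex.ext <;> norm_num [sPt, c₀, dS, Site.toComplex, pow_succ]

/-- `tPt` of the start corner. [folklore] -/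
theorem tPt_c₀ : tPt (c₀ L) = ⟨L + 3 / 8, -(1 / 8)⟩ := by
  apply Complex.ext <;> norm_num [tPt, c₀, dT, Site.toComplex, pow_succ]

/-- `sPt` of the free-arc dart. [folklore] -/
theorem sPt_qX : sPt (qX X) = ⟨X + 1 / 8, -(3 / 8)⟩ := by
  apply Complex.ext <;> norm_num [sPt, qX, dS, Site.toComplex, pow_succ]

/-- `tPt` of the corner `(x, 2)` preceding the free-arc dart. [folklore] -/
theorem tPt_pred : tPt (![X, 0], 2) = ⟨X - 1 / 8, -(3 / 8)⟩ := by
  apply Complex.ext <;> norm_num [tPt, dT, Site.toComplex, pow_succ]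
  ring

/-- Values of the vertex sequence on one period. [folklore] -/
theorem cyc_natCast {i : ℕ} (hi : i < 2 * j + 3) : cyc β L X j i = vert β L X j i := by
  unfold cyc
  rw [← Int.natCast_mod, Int.toNat_natCast, Nat.mod_eq_of_lt hi]

/-- Periodicity of the vertex sequence. [folklore] -/
theorem cyc_add_period (i : ℤ) : cyc β L X j (i + ((2 * j + 3 : ℕ) : ℤ)) = cyc β L X j i := by
  unfold cyc; rw [Int.add_emod_right]

/-- The vertex after the last one is the first one. [folklore] -/
theorem cyc_period : cyc β L X j ((2 * j + 3 : ℕ) : ℤ) = vert β L X j 0 := by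
  have := cyc_add_period (β := β) (L := L) (X := X) (j := j) 0
  rw [zero_add] at this
  rw [this]
  have h0 := cyc_natCast (β := β) (L := L) (X := X) (j := j) (i := 0) (by omega)
  rw [Nat.cast_zero] at h0
  exact h0

/-- Prefix vertices. [folklore] -/
theorem vert_of_le {i : ℕ} (hi : i ≤ 2 * j) : vert β L X j i = pieceVert β (c₀ L) i := by
  unfold vert; rw [if_pos hi]

/-- The vertex `2j + 1`. [folklore] -/
theorem vert_D₁ : vert β L X j (2 * j + 1) = D₁ X := by
  unfold vert; rw [if_neg (by omega), if_pos rfl]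

/-- The vertex `2j + 2`. [folklore] -/
theorem vert_D₂ : vert β L X j (2 * j + 2) = D₂ L := by
  unfold vert; rw [if_neg (by omega), if_neg (by omega)]

end Setup

/-! ### The hypotheses and the pieces of the interface prefix -/

section Pieces

variable {β : Percolation.BondConfig (Site 2)} {L X : ℤ} {j : ℕ}

local notation "orb" => cornerOrbit β (c₀ L)

/-- **The hypotheses of the closing argument**: the free-arc dart `qX X = ((X, 0), 3)` to the right
of the start corner `c₀ L = ((L, 0), 3)` is the `j`-th corner of the orbit of the start corner,
the orbit is injective up to `j` (the interface has not yet exited), its left vertices have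
nonnegative height (they lie in the closed upper half-plane, the free arc being the row below),
and the edge from `(X, 0)` down to the free arc is closed. [cite: Smirnov2001, §2] -/
structure Hyp (β : Percolation.BondConfig (Site 2)) (L X : ℤ) (j : ℕ) : Prop where
  /-- the dart is to the right of the start corner -/
  lt : L < X
  /-- the dart is not the start corner -/
  one_le : 1 ≤ j
  /-- the dart is the `j`-th corner of the orbit -/
  orb_eq : cornerOrbit β (c₀ L) j = qX X
  /-- the orbit is injective up to `j` -/
  inj : ∀ m m', m ≤ j → m' ≤ j → cornerOrbit β (c₀ L) m = cornerOrbit β (c₀ L) m' → m = m'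
  /-- left vertices have nonnegative height -/
  height : ∀ m ≤ j, 0 ≤ (cornerOrbit β (c₀ L) m).1 1
  /-- the edge from `(X, 0)` down to the free arc is closed -/
  closed : cTgt (![X, 0], (2 : Fin 4)) ∉ β

/-- `sPt` and `tPt` of the start corner differ. [folklore] -/
theorem sPt_c₀_ne_tPt_c₀ : sPt (c₀ L) ≠ tPt (c₀ L) := by
  rw [sPt_c₀, tPt_c₀]
  intro h
  have := congrArg Complex.im h
  norm_num at this

/-- A point of the vertical closing segment below `P = (R + 1/8, -3/8)` at height `≥ -3/8` is `P`.
[folklore] -/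
theorem eq_top_of_mem_vertical {R : ℤ} {z : ℂ} (hz : z ∈ segment ℝ (⟨R + 1 / 8, -(3 / 8)⟩ : ℂ) ⟨R + 1 / 8, -(1 / 2)⟩)
    (him : -(3 / 8 : ℝ) ≤ z.im) : z = ⟨R + 1 / 8, -(3 / 8)⟩ := by
  rw [segment_eq_image'] at hz
  obtain ⟨t, ⟨ht0, ht1⟩, rfl⟩ := hz
  dsimp only at him ⊢
  have him' : (⟨R + 1 / 8, -(3 / 8)⟩ + t • ((⟨R + 1 / 8, -(1 / 2)⟩ : ℂ) - ⟨R + 1 / 8, -(3 / 8)⟩) : ℂ).im =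
      -(3 / 8) - t / 8 := by
    simp [Complex.add_im, Complex.sub_im]; ring
  rw [him'] at him
  have ht : t = 0 := by linarith
  rw [ht, zero_smul, add_zero]

variable (H : Hyp β L X j)
include H

/-- The corner before the dart is `((X, 0), 2)`: the dart is reached by crossing the closed edge
below `(X, 0)`. [cite: Smirnov2001, §2] -/
theorem orb_pred : orb (j - 1) = (![X, 0], 2) := by
  obtain ⟨i, hi⟩ : ∃ i, j = i + 1 := ⟨j - 1, by have := H.one_le; omega⟩
  have h1 : nextCorner β (orb (j - 1)) = qX X := by
    rw [← H.orb_eq, hi, Nat.add_sub_cancel]; rfl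
  have h2 : nextCorner β (![X, 0], 2) = qX X := by
    rw [nextCorner_of_not_mem H.closed]; rfl
  exact nextCorner_injective (h1.trans h2.symm)

/-- The turn into the dart is a vertex turn (`+1`). [cite: Smirnov2001, §2] -/
theorem turnSign_pred : turnSign β (orb (j - 1)) = 1 := by
  classical
  rw [orb_pred H, turnSign, if_neg H.closed]

/-- **Every point of a prefix piece has height at least `-3/8`.** [folklore] -/
theorem im_ge_of_mem_prefix {a : ℕ} (ha : a < 2 * j) {z : ℂ}
    (hz : z ∈ segment ℝ (pieceVert β (c₀ L) a) (pieceVert β (c₀ L) (a + 1))) : -(3 / 8 : ℝ) ≤ z.im := by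
  have hv : ∀ m ≤ j, -(3 / 8 : ℝ) ≤ (sPt (orb m)).im ∧ -(3 / 8 : ℝ) ≤ (tPt (orb m)).im := by
    intro m hm
    have h0 : (0 : ℝ) ≤ (orb m).1 1 := by exact_mod_cast H.height m hm
    exact ⟨by linarith [im_sPt_ge (orb m)], by linarith [im_tPt_ge (orb m)]⟩
  obtain ⟨m, rfl | rfl⟩ := Nat.even_or_odd' a
  · rw [pieceVert_even, pieceVert_odd] at hz
    exact im_ge_of_mem_segment (hv m (by omega)).1 (hv m (by omega)).2 hz
  · rw [pieceVert_odd, show 2 * m + 1 + 1 = 2 * (m + 1) by ring, pieceVert_even] at hz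
    exact im_ge_of_mem_segment (hv m (by omega)).2 (hv (m + 1) (by omega)).1 hz

/-- **Non-adjacent prefix pieces are disjoint** (as `pieceVert_disjoint`, with the injectivity of
the prefix in place of the minimal period). [folklore] -/
theorem prefix_disjoint {a b : ℕ} (ha : a < 2 * j) (hb : b < 2 * j) (h0 : b ≠ a) (h1 : b ≠ a + 1) (h2 : a ≠ b + 1) :
    Disjoint (segment ℝ (pieceVert β (c₀ L) a) (pieceVert β (c₀ L) (a + 1)))
      (segment ℝ (pieceVert β (c₀ L) b) (pieceVert β (c₀ L) (b + 1))) := by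
  rw [Set.disjoint_left]
  intro z hz hz'
  obtain ⟨m, rfl | rfl⟩ := Nat.even_or_odd' a <;> obtain ⟨m', rfl | rfl⟩ := Nat.even_or_odd' b
  · -- dart / dart
    rw [pieceVert_even, pieceVert_odd] at hz hz'
    have := H.inj m m' (by omega) (by omega) (eq_of_mem_dart_dart hz hz').symm
    omega
  · -- dart / connector
    rw [pieceVert_even, pieceVert_odd] at hz
    rw [pieceVert_odd, show 2 * m' + 1 + 1 = 2 * (m' + 1) by ring, pieceVert_even] at hz'
    rcases orb_eq_of_mem_dart_conn hz hz' with h | h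
    · have := H.inj m' m (by omega) (by omega) h; omega
    · have := H.inj (m' + 1) m (by omega) (by omega) h; omega
  · -- connector / dart
    rw [pieceVert_odd, show 2 * m + 1 + 1 = 2 * (m + 1) by ring, pieceVert_even] at hz
    rw [pieceVert_even, pieceVert_odd] at hz'
    rcases orb_eq_of_mem_dart_conn hz' hz with h | h
    · have := H.inj m m' (by omega) (by omega) h; omega
    · have := H.inj (m + 1) m' (by omega) (by omega) h; omega
  · -- connector / connector
    rw [pieceVert_odd, show 2 * m + 1 + 1 = 2 * (m + 1) by ring, pieceVert_even] at hz
    rw [pieceVert_odd, show 2 * m' + 1 + 1 = 2 * (m' + 1) by ring, pieceVert_even] at hz'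
    have := H.inj m' m (by omega) (by omega) (orb_eq_of_mem_conn_conn hz hz')
    omega

/-- **`sPt qX` lies only on the last prefix piece** (the connector into the dart). [folklore] -/
theorem eq_of_sPt_qX_mem {a : ℕ} (ha : a < 2 * j)
    (hz : sPt (qX X) ∈ segment ℝ (pieceVert β (c₀ L) a) (pieceVert β (c₀ L) (a + 1))) : a = 2 * j - 1 := by
  have hq : sPt (qX X) ∈ segment ℝ (sPt (orb j)) (tPt (orb j)) := by
    rw [H.orb_eq]; exact left_mem_segment _ _ _
  obtain ⟨m, rfl | rfl⟩ := Nat.even_or_odd' a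
  · rw [pieceVert_even, pieceVert_odd] at hz
    have := H.inj j m le_rfl (by omega) (eq_of_mem_dart_dart hz hq)
    omega
  · rw [pieceVert_odd, show 2 * m + 1 + 1 = 2 * (m + 1) by ring, pieceVert_even] at hz
    rcases orb_eq_of_mem_dart_conn hq hz with h | h
    · have := H.inj m j (by omega) le_rfl h; omega
    · have := H.inj (m + 1) j (by omega) le_rfl h; omega

/-- **`sPt c₀` lies only on the first prefix piece** (the first dart). [folklore] -/
theorem eq_of_sPt_c₀_mem {a : ℕ} (ha : a < 2 * j)
    (hz : sPt (c₀ L) ∈ segment ℝ (pieceVert β (c₀ L) a) (pieceVert β (c₀ L) (a + 1))) : a = 0 := by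
  have h0 : sPt (c₀ L) ∈ segment ℝ (sPt (orb 0)) (tPt (orb 0)) := left_mem_segment _ _ _
  obtain ⟨m, rfl | rfl⟩ := Nat.even_or_odd' a
  · rw [pieceVert_even, pieceVert_odd] at hz
    have := H.inj 0 m (Nat.zero_le _) (by omega) (eq_of_mem_dart_dart hz h0)
    omega
  · rw [pieceVert_odd, show 2 * m + 1 + 1 = 2 * (m + 1) by ring, pieceVert_even] at hz
    rcases orb_eq_of_mem_dart_conn h0 hz with h | h
    · have hm := H.inj m 0 (by omega) (Nat.zero_le _) h
      subst hm
      -- the first dart and the first connector meet only at `tPt c₀`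
      have hmem := dart_inter_conn_subset (β := β) (c₀ L) ⟨h0, hz⟩
      rw [Set.mem_singleton_iff] at hmem
      exact absurd hmem sPt_c₀_ne_tPt_c₀
    · have := H.inj (m + 1) 0 (by omega) (Nat.zero_le _) h; omega

/-- **The first closing edge `[sPt qX, D₁]` meets a prefix piece only if it is the last one.**
[folklore] -/
theorem E₁_disjoint {a : ℕ} (ha : a < 2 * j) (ha' : a ≠ 2 * j - 1) :
    Disjoint (segment ℝ (pieceVert β (c₀ L) a) (pieceVert β (c₀ L) (a + 1))) (segment ℝ (sPt (qX X)) (D₁ X)) := by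
  rw [Set.disjoint_left]
  intro z hz hz'
  have him := im_ge_of_mem_prefix H ha hz
  rw [sPt_qX, D₁] at hz'
  have heq := eq_top_of_mem_vertical hz' him
  rw [heq, ← sPt_qX] at hz
  exact ha' (eq_of_sPt_qX_mem H ha hz)

/-- **The third closing edge `[D₂, sPt c₀]` meets a prefix piece only if it is the first one.**
[folklore] -/
theorem E₃_disjoint {a : ℕ} (ha : a < 2 * j) (ha' : a ≠ 0) :
    Disjoint (segment ℝ (pieceVert β (c₀ L) a) (pieceVert β (c₀ L) (a + 1))) (segment ℝ (D₂ L) (sPt (c₀ L))) := by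
  rw [Set.disjoint_left]
  intro z hz hz'
  have him := im_ge_of_mem_prefix H ha hz
  rw [sPt_c₀, D₂, segment_symm] at hz'
  have heq := eq_top_of_mem_vertical hz' him
  rw [heq, ← sPt_c₀] at hz
  exact ha' (eq_of_sPt_c₀_mem H ha hz)

/-- **The bottom closing edge `[D₁, D₂]` misses every prefix piece** (it lies at height `-1/2`).
[folklore] -/
theorem E₂_disjoint {a : ℕ} (ha : a < 2 * j) :
    Disjoint (segment ℝ (pieceVert β (c₀ L) a) (pieceVert β (c₀ L) (a + 1))) (segment ℝ (D₁ X) (D₂ L)) := by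
  rw [Set.disjoint_left]
  intro z hz hz'
  have him := im_ge_of_mem_prefix H ha hz
  rw [segment_eq_image'] at hz'
  obtain ⟨t, -, rfl⟩ := hz'
  dsimp only at him
  simp [D₁, D₂, Complex.add_im, Complex.sub_im] at him
  norm_num at him

/-- The two vertical closing edges are disjoint (`L ≠ X`). [folklore] -/
theorem E₁_E₃_disjoint : Disjoint (segment ℝ (sPt (qX X)) (D₁ X)) (segment ℝ (D₂ L) (sPt (c₀ L))) := by
  rw [Set.disjoint_left]
  intro z hz hz'
  rw [sPt_qX, D₁, segment_eq_image'] at hz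
  rw [sPt_c₀, D₂, segment_eq_image'] at hz'
  obtain ⟨t, -, rfl⟩ := hz
  obtain ⟨s, -, hs⟩ := hz'
  have hre := congrArg Complex.re hs
  simp [Complex.add_re, Complex.sub_re] at hre
  exact H.lt.ne hre

end Pieces

/-! ### The closed polygon is simple -/

section Simple

variable {β : Percolation.BondConfig (Site 2)} {L X : ℤ} {j : ℕ} (H : Hyp β L X j)

local notation "orb" => cornerOrbit β (c₀ L)
local notation "zz" => cyc β L X j

/-- Prefix vertices of the `ℤ`-indexed sequence. [folklore] -/
theorem cyc_prefix {a : ℕ} (ha : a ≤ 2 * j) : zz (a : ℤ) = pieceVert β (c₀ L) a := by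
  rw [cyc_natCast (by omega), vert_of_le ha]

include H in
/-- The vertex `2j` is `sPt qX`. [folklore] -/
theorem cyc_two_j : zz ((2 * j : ℕ) : ℤ) = sPt (qX X) := by
  rw [cyc_prefix le_rfl, pieceVert_even, H.orb_eq]

include H in
/-- The vertex `2j - 1` is `tPt ((X, 0), 2)`. [folklore] -/
theorem cyc_two_j_sub_one : zz ((2 * j - 1 : ℕ) : ℤ) = tPt (![X, 0], 2) := by
  obtain ⟨i, hi⟩ : ∃ i, j = i + 1 := ⟨j - 1, by have := H.one_le; omega⟩
  rw [cyc_prefix (by omega), show 2 * j - 1 = 2 * i + 1 by omega, pieceVert_odd, ← orb_pred H, hi, Nat.add_sub_cancel]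

/-- The vertex `2j + 1` is `D₁`. [folklore] -/
theorem cyc_two_j_add_one : zz ((2 * j + 1 : ℕ) : ℤ) = D₁ X := by
  rw [cyc_natCast (by omega), vert_D₁]

/-- The vertex `2j + 2` is `D₂`. [folklore] -/
theorem cyc_two_j_add_two : zz ((2 * j + 2 : ℕ) : ℤ) = D₂ L := by
  rw [cyc_natCast (by omega), vert_D₂]

/-- The vertex `2j + 3` is `sPt c₀`. [folklore] -/
theorem cyc_two_j_add_three : zz ((2 * j + 3 : ℕ) : ℤ) = sPt (c₀ L) := by
  rw [cyc_period, vert_of_le (Nat.zero_le _), show (0 : ℕ) = 2 * 0 from rfl, pieceVert_even]; rfl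

/-- The vertex `0` is `sPt c₀`. [folklore] -/
theorem cyc_zero : zz 0 = sPt (c₀ L) := by
  rw [show (0 : ℤ) = ((0 : ℕ) : ℤ) from rfl, cyc_prefix (Nat.zero_le _), show (0 : ℕ) = 2 * 0 from rfl, pieceVert_even]; rfl

/-- The vertex `1` is `tPt c₀`. [folklore] -/
theorem cyc_one (hj : 1 ≤ j) : zz 1 = tPt (c₀ L) := by
  rw [show (1 : ℤ) = ((1 : ℕ) : ℤ) from rfl, cyc_prefix (by omega), show (1 : ℕ) = 2 * 0 + 1 from rfl, pieceVert_odd]; rfl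

/-- The vertex `-1` is `D₂`. [folklore] -/
theorem cyc_neg_one : zz (-1) = D₂ L := by
  rw [← cyc_add_period, show (-1 : ℤ) + ((2 * j + 3 : ℕ) : ℤ) = ((2 * j + 2 : ℕ) : ℤ) by push_cast; ring, cyc_two_j_add_two]

/-- **Edges with independent directions sharing an endpoint meet only there**, the closing corners:
at `sPt c₀`. [folklore] -/
theorem adj_at_zero : segment ℝ (D₂ L) (sPt (c₀ L)) ∩ segment ℝ (sPt (c₀ L)) (tPt (c₀ L)) ⊆ {sPt (c₀ L)} := by
  apply segment_inter_segment_subset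
  rw [sPt_c₀, tPt_c₀, D₂]
  norm_num [Complex.mul_im, Complex.conj_re, Complex.conj_im]

/-- The closing corner at `sPt qX`. [folklore] -/
theorem adj_at_two_j : segment ℝ (tPt (![X, 0], 2)) (sPt (qX X)) ∩ segment ℝ (sPt (qX X)) (D₁ X) ⊆ {sPt (qX X)} := by
  apply segment_inter_segment_subset
  rw [sPt_qX, tPt_pred, D₁]
  norm_num [Complex.mul_im, Complex.conj_re, Complex.conj_im]

include H in
/-- The closing corner at `D₁`. [folklore] -/
theorem adj_at_D₁ : segment ℝ (sPt (qX X)) (D₁ X) ∩ segment ℝ (D₁ X) (D₂ L) ⊆ {D₁ X} := by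
  apply segment_inter_segment_subset
  rw [sPt_qX, D₁, D₂]
  have hLX : (L : ℝ) < X := by exact_mod_cast H.lt
  norm_num [Complex.mul_im, Complex.conj_re, Complex.conj_im]
  linarith

include H in
/-- The closing corner at `D₂`. [folklore] -/
theorem adj_at_D₂ : segment ℝ (D₁ X) (D₂ L) ∩ segment ℝ (D₂ L) (sPt (c₀ L)) ⊆ {D₂ L} := by
  apply segment_inter_segment_subset
  rw [sPt_c₀, D₁, D₂]
  have hLX : (L : ℝ) < X := by exact_mod_cast H.lt
  norm_num [Complex.mul_im, Complex.conj_re, Complex.conj_im]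
  linarith

include H in
/-- **The closed polygon is a simple closed polygon.** [folklore] -/
theorem isSimplePolygon_cyc : IsSimplePolygon (cyc β L X j) (2 * j + 3) := by
  have hj := H.one_le
  have hLX : (L : ℝ) ≠ X := by exact_mod_cast H.lt.ne
  -- one more name for the cast of `a + 1`
  have cs : ∀ a : ℕ, (a : ℤ) + 1 = ((a + 1 : ℕ) : ℤ) := fun a => by push_cast; ring
  refine IsSimplePolygon.of_Ico (by omega) cyc_add_period (fun i hi0 hi => ?_) (fun i i' hi0 hi hi0' hi' h0 h1 h2 => ?_)
    (fun i hi0 hi => ?_)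
  · -- consecutive vertices are distinct
    obtain ⟨a, rfl⟩ := Int.eq_ofNat_of_zero_le hi0
    have ha : a < 2 * j + 3 := by exact_mod_cast hi
    rw [cs]
    rcases Nat.lt_or_ge a (2 * j) with hlt | hge
    · rw [cyc_prefix (by omega), cyc_prefix (by omega)]; exact pieceVert_succ_ne a
    · rcases (by omega : a = 2 * j ∨ a = 2 * j + 1 ∨ a = 2 * j + 2) with rfl | rfl | rfl
      · rw [cyc_two_j H, cyc_two_j_add_one, sPt_qX, D₁]
        intro h; have := congrArg Complex.im h; norm_num at this
      · rw [cyc_two_j_add_one, show 2 * j + 1 + 1 = 2 * j + 2 by ring, cyc_two_j_add_two, D₁, D₂]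
        intro h; have := congrArg Complex.re h; simp at this; exact H.lt.ne this
      · rw [cyc_two_j_add_two, show 2 * j + 2 + 1 = 2 * j + 3 by ring, cyc_two_j_add_three, sPt_c₀, D₂]
        intro h; have := congrArg Complex.im h; norm_num at this
  · -- non-adjacent edges are disjoint
    obtain ⟨a, rfl⟩ := Int.eq_ofNat_of_zero_le hi0
    obtain ⟨b, rfl⟩ := Int.eq_ofNat_of_zero_le hi0'
    have ha : a < 2 * j + 3 := by exact_mod_cast hi
    have hb : b < 2 * j + 3 := by exact_mod_cast hi'
    have h0' : b ≠ a := fun h => h0 (by rw [h])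
    have h1' : b ≠ (a + 1) % (2 * j + 3) := fun h => h1 (by rw [cs a, ← Int.natCast_mod]; exact_mod_cast h)
    have h2' : a ≠ (b + 1) % (2 * j + 3) := fun h => h2 (by rw [cs b, ← Int.natCast_mod]; exact_mod_cast h)
    rw [cs a, cs b]
    -- the edge of index `e`, as a segment of explicit points
    have edge : ∀ e : ℕ, e < 2 * j + 3 →
        (e < 2 * j → segment ℝ (zz (e : ℤ)) (zz ((e + 1 : ℕ) : ℤ)) =
          segment ℝ (pieceVert β (c₀ L) e) (pieceVert β (c₀ L) (e + 1))) ∧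
        (e = 2 * j → segment ℝ (zz (e : ℤ)) (zz ((e + 1 : ℕ) : ℤ)) = segment ℝ (sPt (qX X)) (D₁ X)) ∧
        (e = 2 * j + 1 → segment ℝ (zz (e : ℤ)) (zz ((e + 1 : ℕ) : ℤ)) = segment ℝ (D₁ X) (D₂ L)) ∧
        (e = 2 * j + 2 → segment ℝ (zz (e : ℤ)) (zz ((e + 1 : ℕ) : ℤ)) = segment ℝ (D₂ L) (sPt (c₀ L))) := by
      intro e _
      refine ⟨fun he => ?_, fun he => ?_, fun he => ?_, fun he => ?_⟩
      · rw [cyc_prefix (by omega), cyc_prefix (by omega)]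
      · subst he; rw [cyc_two_j H, cyc_two_j_add_one]
      · subst he; rw [cyc_two_j_add_one, show 2 * j + 1 + 1 = 2 * j + 2 by ring, cyc_two_j_add_two]
      · subst he; rw [cyc_two_j_add_two, show 2 * j + 2 + 1 = 2 * j + 3 by ring, cyc_two_j_add_three]
    obtain ⟨eaP, ea1, ea2, ea3⟩ := edge a ha
    obtain ⟨ebP, eb1, eb2, eb3⟩ := edge b hb
    rcases Nat.lt_or_ge a (2 * j) with hal | hag <;> rcases Nat.lt_or_ge b (2 * j) with hbl | hbg
    · rw [eaP hal, ebP hbl]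
      refine prefix_disjoint H hal hbl h0' (fun h => h1' ?_) (fun h => h2' ?_)
      · rw [Nat.mod_eq_of_lt (by omega)]; exact h
      · rw [Nat.mod_eq_of_lt (by omega)]; exact h
    · rw [eaP hal]
      rcases (by omega : b = 2 * j ∨ b = 2 * j + 1 ∨ b = 2 * j + 2) with rfl | rfl | rfl
      · rw [eb1 rfl]
        exact E₁_disjoint H hal (fun h => h1' (by rw [Nat.mod_eq_of_lt (by omega)]; omega))
      · rw [eb2 rfl]; exact E₂_disjoint H hal
      · rw [eb3 rfl]
        exact E₃_disjoint H hal (fun h => h2' (by rw [h, show 2 * j + 2 + 1 = 2 * j + 3 by ring, Nat.mod_self]))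
    · rw [ebP hbl]
      rcases (by omega : a = 2 * j ∨ a = 2 * j + 1 ∨ a = 2 * j + 2) with rfl | rfl | rfl
      · rw [ea1 rfl]
        exact (E₁_disjoint H hbl (fun h => h2' (by rw [Nat.mod_eq_of_lt (by omega)]; omega))).symm
      · rw [ea2 rfl]; exact (E₂_disjoint H hbl).symm
      · rw [ea3 rfl]
        exact (E₃_disjoint H hbl (fun h => h1' (by rw [h, show 2 * j + 2 + 1 = 2 * j + 3 by ring, Nat.mod_self]))).symm
    · -- both closing edges: only `(2j, 2j+2)` is non-adjacent
      rcases (by omega : a = 2 * j ∨ a = 2 * j + 1 ∨ a = 2 * j + 2) with rfl | rfl | rfl <;>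
        rcases (by omega : b = 2 * j ∨ b = 2 * j + 1 ∨ b = 2 * j + 2) with rfl | rfl | rfl
      · exact absurd rfl h0'
      · exfalso; apply h1'; rw [Nat.mod_eq_of_lt (by omega)]
      · rw [ea1 rfl, eb3 rfl]; exact E₁_E₃_disjoint H
      · exfalso; apply h2'; rw [Nat.mod_eq_of_lt (by omega)]
      · exact absurd rfl h0'
      · exfalso; apply h1'; rw [Nat.mod_eq_of_lt (by omega)]
      · rw [ea3 rfl, eb1 rfl]; exact (E₁_E₃_disjoint H).symm
      · exfalso; apply h2'; rw [Nat.mod_eq_of_lt (by omega)]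
      · exact absurd rfl h0'
  · -- adjacent edges meet only at the common vertex
    obtain ⟨a, rfl⟩ := Int.eq_ofNat_of_zero_le hi0
    have ha : a < 2 * j + 3 := by exact_mod_cast hi
    rcases Nat.eq_zero_or_pos a with rfl | hapos
    · rw [Nat.cast_zero, zero_sub, cyc_neg_one, zero_add, cyc_zero, cyc_one hj]
      exact adj_at_zero
    rcases Nat.lt_or_ge a (2 * j) with hal | hag
    · obtain ⟨b, rfl⟩ : ∃ b, a = b + 1 := ⟨a - 1, by omega⟩
      rw [show ((b + 1 : ℕ) : ℤ) - 1 = (b : ℤ) by push_cast; ring, cs, cyc_prefix (by omega), cyc_prefix (by omega),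
        cyc_prefix (by omega)]
      exact pieceVert_adjacent b
    · rcases (by omega : a = 2 * j ∨ a = 2 * j + 1 ∨ a = 2 * j + 2) with rfl | rfl | rfl
      · rw [show ((2 * j : ℕ) : ℤ) - 1 = ((2 * j - 1 : ℕ) : ℤ) by omega, cs, cyc_two_j_sub_one H, cyc_two_j H,
          cyc_two_j_add_one]
        exact adj_at_two_j
      · rw [show ((2 * j + 1 : ℕ) : ℤ) - 1 = ((2 * j : ℕ) : ℤ) by push_cast; ring, cs, cyc_two_j H, cyc_two_j_add_one,
          show 2 * j + 1 + 1 = 2 * j + 2 by ring, cyc_two_j_add_two]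
        exact adj_at_D₁ H
      · rw [show ((2 * j + 2 : ℕ) : ℤ) - 1 = ((2 * j + 1 : ℕ) : ℤ) by push_cast; ring, cs, cyc_two_j_add_one, cyc_two_j_add_two,
          show 2 * j + 2 + 1 = 2 * j + 3 by ring, cyc_two_j_add_three]
        exact adj_at_D₂ H

end Simple

/-! ### The exterior angles of the closed polygon -/

section Angles

variable {β : Percolation.BondConfig (Site 2)} {L X : ℤ} {j : ℕ} (H : Hyp β L X j)

local notation "orb" => cornerOrbit β (c₀ L)
local notation "zz" => cyc β L X j

/-- **The two angles of an interior turn of the prefix add up to `(π/2) · turnSign`** (as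
`extAngle_pair`). [folklore] -/
theorem extAngle_pair_prefix {m : ℕ} (hm : m + 2 ≤ j) :
    extAngle zz ((2 * m : ℕ) + 1) + extAngle zz ((2 * m + 1 : ℕ) + 1) = Real.pi / 2 * turnSign β (orb m) := by
  have e1 : extAngle zz ((2 * m : ℕ) + 1) = Real.pi / 4 * turnSign β (orb m) := by
    rw [extAngle, show ((2 * m : ℕ) : ℤ) + 1 + 1 = ((2 * m + 2 : ℕ) : ℤ) by push_cast; ring,
      show ((2 * m : ℕ) : ℤ) + 1 - 1 = ((2 * m : ℕ) : ℤ) by ring, show ((2 * m : ℕ) : ℤ) + 1 = ((2 * m + 1 : ℕ) : ℤ) by push_cast; ring,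
      cyc_prefix (by omega), cyc_prefix (by omega), cyc_prefix (by omega), pieceVert_odd_succ, pieceVert_odd, pieceVert_even]
    exact arg_at_tPt _
  have e2 : extAngle zz ((2 * m + 1 : ℕ) + 1) = Real.pi / 4 * turnSign β (orb m) := by
    rw [extAngle, show ((2 * m + 1 : ℕ) : ℤ) + 1 + 1 = ((2 * m + 3 : ℕ) : ℤ) by push_cast; ring,
      show ((2 * m + 1 : ℕ) : ℤ) + 1 - 1 = ((2 * m + 1 : ℕ) : ℤ) by ring,
      show ((2 * m + 1 : ℕ) : ℤ) + 1 = ((2 * m + 2 : ℕ) : ℤ) by push_cast; ring,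
      cyc_prefix (by omega), cyc_prefix (by omega), cyc_prefix (by omega), pieceVert_odd_succ_succ, pieceVert_odd_succ,
      pieceVert_odd]
    exact arg_at_sPt _
  rw [e1, e2]; ring

include H in
/-- **The angle at the last target point** (a vertex turn into the dart): `π/4`. [folklore] -/
theorem extAngle_last_tPt : extAngle zz ((2 * j - 1 : ℕ) : ℤ) = Real.pi / 4 := by
  obtain ⟨i, hi⟩ : ∃ i, j = i + 1 := ⟨j - 1, by have := H.one_le; omega⟩
  have hts := turnSign_pred H
  rw [hi, Nat.add_sub_cancel] at hts
  have key := arg_at_tPt (β := β) (orb i)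
  rw [hts, Int.cast_one, mul_one] at key
  rw [extAngle, show ((2 * j - 1 : ℕ) : ℤ) + 1 = ((2 * i + 2 : ℕ) : ℤ) by omega,
    show ((2 * j - 1 : ℕ) : ℤ) - 1 = ((2 * i : ℕ) : ℤ) by omega, show ((2 * j - 1 : ℕ) : ℤ) = ((2 * i + 1 : ℕ) : ℤ) by omega,
    cyc_prefix (by omega), cyc_prefix (by omega), cyc_prefix (by omega), pieceVert_odd_succ, pieceVert_odd, pieceVert_even]
  exact key

/-- The argument of a positive real multiple. [folklore] -/
theorem arg_eq_of_eq_real_mul {w v : ℂ} {r : ℝ} (hr : 0 < r) (h : w = r * v) : arg w = arg v := by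
  rw [h, Complex.arg_real_mul _ hr]

include H in
/-- **The angle at `sPt qX`** (from the horizontal connector down): `-π/2`. [folklore] -/
theorem extAngle_sPt_qX : extAngle zz ((2 * j : ℕ) : ℤ) = -(Real.pi / 2) := by
  rw [extAngle, show ((2 * j : ℕ) : ℤ) + 1 = ((2 * j + 1 : ℕ) : ℤ) by push_cast; ring,
    show ((2 * j : ℕ) : ℤ) - 1 = ((2 * j - 1 : ℕ) : ℤ) by have := H.one_le; omega,
    cyc_two_j H, cyc_two_j_add_one, cyc_two_j_sub_one H, sPt_qX, tPt_pred, D₁, ← Complex.arg_neg_I]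
  refine arg_eq_of_eq_real_mul (r := 1 / 2) (by norm_num) ?_
  rw [div_eq_iff (by intro h; have := congrArg Complex.re h; norm_num at this)]
  apply Complex.ext <;> norm_num

include H in
/-- **The angle at `D₁`**: `-π/2`. [folklore] -/
theorem extAngle_D₁ : extAngle zz ((2 * j + 1 : ℕ) : ℤ) = -(Real.pi / 2) := by
  have hLX' : (L : ℝ) < X := by exact_mod_cast H.lt
  have hLX : (0 : ℝ) < X - L := by linarith
  rw [extAngle, show ((2 * j + 1 : ℕ) : ℤ) + 1 = ((2 * j + 2 : ℕ) : ℤ) by push_cast; ring,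
    show ((2 * j + 1 : ℕ) : ℤ) - 1 = ((2 * j : ℕ) : ℤ) by push_cast; ring,
    cyc_two_j H, cyc_two_j_add_one, cyc_two_j_add_two, sPt_qX, D₁, D₂, ← Complex.arg_neg_I]
  refine arg_eq_of_eq_real_mul (r := 8 * (X - L)) (by positivity) ?_
  rw [div_eq_iff (by intro h; have := congrArg Complex.im h; norm_num at this)]
  apply Complex.ext
  · norm_num; ring
  · norm_num

include H in
/-- **The angle at `D₂`**: `-π/2`. [folklore] -/
theorem extAngle_D₂ : extAngle zz ((2 * j + 2 : ℕ) : ℤ) = -(Real.pi / 2) := by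
  have hLX' : (L : ℝ) < X := by exact_mod_cast H.lt
  have hLX : (0 : ℝ) < X - L := by linarith
  rw [extAngle, show ((2 * j + 2 : ℕ) : ℤ) + 1 = ((2 * j + 3 : ℕ) : ℤ) by push_cast; ring,
    show ((2 * j + 2 : ℕ) : ℤ) - 1 = ((2 * j + 1 : ℕ) : ℤ) by push_cast; ring,
    cyc_two_j_add_one, cyc_two_j_add_two, cyc_two_j_add_three, sPt_c₀, D₁, D₂, ← Complex.arg_neg_I]
  set r : ℝ := 1 / (8 * (X - L)) with hr
  have hr0 : 0 < r := by positivity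
  refine arg_eq_of_eq_real_mul (r := r) hr0 ?_
  rw [div_eq_iff (by intro h; have := congrArg Complex.re h; norm_num at this; linarith)]
  have h8 : r * (8 * (X - L)) = 1 := by rw [hr]; field_simp
  apply Complex.ext
  · simp [Complex.mul_re, Complex.mul_im]
  · simp [Complex.mul_re, Complex.mul_im]
    nlinarith [h8]

include H in
/-- **The angle at `sPt c₀`** (from the vertical closing edge into the first dart): `-π/4`.
[folklore] -/
theorem extAngle_sPt_c₀ : extAngle zz ((2 * j + 3 : ℕ) : ℤ) = -(Real.pi / 4) := by
  have hper : extAngle zz ((0 : ℤ) + ((2 * j + 3 : ℕ) : ℤ)) = extAngle zz 0 := extAngle_add_period cyc_add_period 0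
  rw [zero_add] at hper
  rw [hper, extAngle, zero_add, zero_sub, cyc_zero, cyc_one H.one_le, cyc_neg_one, sPt_c₀, tPt_c₀, D₂, ← arg_one_sub_I]
  refine arg_eq_of_eq_real_mul (r := 2) (by norm_num) ?_
  rw [div_eq_iff (by intro h; have := congrArg Complex.im h; norm_num at this)]
  apply Complex.ext <;> norm_num

include H in
/-- **The total turning of the closed polygon is `(π/2) · turnCount - 2π`.** [folklore] -/
theorem sum_extAngle_cyc :
    ∑ i ∈ Finset.range (2 * j + 3), extAngle zz i = Real.pi / 2 * turnCount β (c₀ L) j - 2 * Real.pi := by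
  obtain ⟨k, hk⟩ : ∃ k, j = k + 1 := ⟨j - 1, by have := H.one_le; omega⟩
  have hper : ∀ i, extAngle zz (i + ((2 * j + 3 : ℕ) : ℤ)) = extAngle zz i := extAngle_add_period cyc_add_period
  rw [← sum_range_shift_of_periodic hper 1, Nat.cast_one]
  -- split off the last five vertices
  rw [show 2 * j + 3 = 2 * k + 1 + 1 + 1 + 1 + 1 by omega]
  simp only [Finset.sum_range_succ]
  rw [sum_range_two_mul (fun i : ℕ => extAngle zz ((i : ℤ) + 1)) k]
  -- the interior turns of the prefix
  have hpairs : ∑ m ∈ Finset.range k, (extAngle zz (((2 * m : ℕ) : ℤ) + 1) + extAngle zz (((2 * m + 1 : ℕ) : ℤ) + 1)) =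
      Real.pi / 2 * ∑ m ∈ Finset.range k, (turnSign β (orb m) : ℝ) := by
    rw [Finset.mul_sum]
    exact Finset.sum_congr rfl fun m hm => extAngle_pair_prefix (by have := Finset.mem_range.1 hm; omega)
  -- the five special angles
  have h1 : extAngle zz (((2 * k : ℕ) : ℤ) + 1) = Real.pi / 4 := by
    rw [show ((2 * k : ℕ) : ℤ) + 1 = ((2 * j - 1 : ℕ) : ℤ) by omega]; exact extAngle_last_tPt H
  have h2 : extAngle zz (((2 * k + 1 : ℕ) : ℤ) + 1) = -(Real.pi / 2) := by
    rw [show ((2 * k + 1 : ℕ) : ℤ) + 1 = ((2 * j : ℕ) : ℤ) by omega]; exact extAngle_sPt_qX H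
  have h3 : extAngle zz (((2 * k + 1 + 1 : ℕ) : ℤ) + 1) = -(Real.pi / 2) := by
    rw [show ((2 * k + 1 + 1 : ℕ) : ℤ) + 1 = ((2 * j + 1 : ℕ) : ℤ) by omega]; exact extAngle_D₁ H
  have h4 : extAngle zz (((2 * k + 1 + 1 + 1 : ℕ) : ℤ) + 1) = -(Real.pi / 2) := by
    rw [show ((2 * k + 1 + 1 + 1 : ℕ) : ℤ) + 1 = ((2 * j + 2 : ℕ) : ℤ) by omega]; exact extAngle_D₂ H
  have h5 : extAngle zz (((2 * k + 1 + 1 + 1 + 1 : ℕ) : ℤ) + 1) = -(Real.pi / 4) := by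
    rw [show ((2 * k + 1 + 1 + 1 + 1 : ℕ) : ℤ) + 1 = ((2 * j + 3 : ℕ) : ℤ) by omega]; exact extAngle_sPt_c₀ H
  rw [hpairs, h1, h2, h3, h4, h5]
  -- the turn count
  have hT : (turnCount β (c₀ L) j : ℝ) = ∑ m ∈ Finset.range k, (turnSign β (orb m) : ℝ) + 1 := by
    have hts := turnSign_pred H
    rw [hk, Nat.add_sub_cancel] at hts
    rw [turnCount, hk, Finset.sum_range_succ, hts]
    push_cast
    ring
  rw [hT]
  ring

include H in
/-- **The winding at a free-arc dart is deterministic**: the signed number of quarter turns of the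
interface from the start corner `((L,0), 3)` to the free-arc dart `((X,0), 3)` (both pointing down
to the free arc below the row `{x₁ = 0}`) is `0` or `8` — in particular `0` modulo `8`, so the
spinor phase `e^{-iπ W/4}` of every passage through a boundary edge of the free arc is `1` (DCHN
2011, proof of Lemma 12: "since the edge `e` is along the free arc, the winding `W_γ(e_a, e)` of
the exploration path `γ` at `e` is constant"; Duminil-Copin–Smirnov 2012, proof of Prop. 7.8).
Proof: close the perturbed polygon of the interface prefix below the free arc (at height `-1/2`)
into a simple closed polygon; its exterior angles sum to `(π/2) · turnCount - 2π`
(`sum_extAngle_cyc`), which is `±2π` by Hopf's Umlaufsatz (`IsSimplePolygon.sum_extAngle_eq`).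
[cite: DuminilCopinHonglerNolin2011, §4, Lemma 12] -/
theorem turnCount_eq_zero_or_eight : turnCount β (c₀ L) j = 0 ∨ turnCount β (c₀ L) j = 8 := by
  have key := (isSimplePolygon_cyc H).sum_extAngle_eq
  rw [sum_extAngle_cyc H] at key
  have hπ : Real.pi ≠ 0 := Real.pi_pos.ne'
  rcases key with h | h
  · right
    have : (turnCount β (c₀ L) j : ℝ) = 8 := by
      have h' : Real.pi / 2 * (turnCount β (c₀ L) j : ℝ) = Real.pi / 2 * 8 := by linarith
      exact mul_left_cancel₀ (by positivity) h'
    exact_mod_cast this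
  · left
    have : (turnCount β (c₀ L) j : ℝ) = 0 := by
      have h' : Real.pi / 2 * (turnCount β (c₀ L) j : ℝ) = Real.pi / 2 * 0 := by linarith
      exact mul_left_cancel₀ (by positivity) h'
    exact_mod_cast this

end Angles

/-! ### The observable at a free-arc dart is the passage probability -/

section Observable

variable {E : DiscreteDobrushin} (hE : E.IsZdAdmissible) {L X : ℤ}

include hE in
/-- **The hypotheses of the closing argument hold for the interface of a Dobrushin domain** whose
start corner is `c₀ L`, whose sites off the free arc have nonnegative height, and with `(X, -1)`
on the free arc, at every visit of the dart `qX X` before the exit. [cite: Smirnov2001, §2] -/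
theorem hyp_of_domain (hc₀ : DiscreteDobrushin.startCorner hE = c₀ L) (hLX : L < X)
    (hheight : ∀ v ∈ meshDomain E.Ω E.δ, v ∉ E.zdArcB → 0 ≤ v 1) (hB : (![X, -1] : Site 2) ∈ E.zdArcB)
    (ω : Percolation.BondConfig (Site 2)) {j : ℕ} (hj : j < DiscreteDobrushin.exitTime hE ω)
    (horb : cornerOrbit (E.bcBondConfig ω) (c₀ L) j = qX X) : Hyp (E.bcBondConfig ω) L X j := by
  have hc : E.IsStartCorner (c₀ L) := hc₀ ▸ DiscreteDobrushin.isStartCorner_startCorner hE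
  have hinner : ∀ k < j + 1, E.IsInnerFace (cFace (cornerOrbit (E.bcBondConfig ω) (c₀ L) k)) := by
    intro k hk
    have := DiscreteDobrushin.isInnerFace_of_lt_exitTime hE ω (k := k) (by omega)
    rwa [hc₀] at this
  refine ⟨hLX, ?_, horb, ?_, ?_, ?_⟩
  · -- `j ≠ 0`: the start corner is not the dart
    by_contra h0
    have hj0 : j = 0 := by omega
    subst hj0
    have : c₀ L = qX X := horb
    have := congrArg (fun p : Site 2 × Fin 4 => p.1 0) this
    simp [c₀, qX] at this
    exact hLX.ne this
  · intro m m' hm hm' h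
    by_contra hne
    rcases Nat.lt_or_gt_of_ne hne with hlt | hlt
    · exact cornerOrbit_ne hE hc hlt (fun k hk => hinner k (by omega)) h
    · exact cornerOrbit_ne hE hc hlt (fun k hk => hinner k (by omega)) h.symm
  · intro m _
    refine hheight _ ?_ (cornerOrbit_fst_not_mem_zdArcB hE hc ω m)
    rcases cornerOrbit_inv hc m with h | ⟨e, he, hxe⟩
    · exact E.zdBoundary_subset_meshDomain (E.zdArcA_subset_zdBoundary h)
    · have he' := E.bcBondConfig_subset ω he
      induction e using Sym2.ind with
      | h u w =>
        rw [SimpleGraph.mem_edgeSet] at he'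
        obtain ⟨-, hu, hw⟩ := discreteDomainGraph_adj_iff.1 he'
        rcases Sym2.mem_iff.1 hxe with h' | h'
        · rw [h']; exact hu
        · rw [h']; exact hw
  · refine DiscreteDobrushin.not_mem_bcBondConfig_of_mem_zdArcB hE (Sym2.mem_mk_right _ _) ?_
    convert hB using 1
    ext k; fin_cases k <;> simp [cornerUnit]

/-- `quarterPhase 0 = 1`. [cite: Smirnov2010, §4] -/
theorem quarterPhase_zero : quarterPhase 0 = 1 := by simp [quarterPhase]

/-- `quarterPhase 8 = 1` (two full twists). [cite: Smirnov2010, Remark 4.2] -/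
theorem quarterPhase_eight : quarterPhase 8 = 1 := by
  have := quarterPhase_add_four_mul 0 2
  rw [zero_add, show (4 : ℤ) * 2 = 8 by norm_num, quarterPhase_zero] at this
  rw [this]; norm_num

include hE in
open scoped Classical in
/-- **The dart observable at a free-arc dart is the passage probability** (DCHN 2011, proof of
Lemma 12: "`P(e ∈ γ) = |F(e)|`"; DCS 2012, proof of Prop. 7.8): for admissible Dobrushin data with
start corner `c₀ L`, sites off the free arc at nonnegative height, `(X, -1)` on the free arc and
the face of `qX X` inner, `F(qX X) = P(cSrc (qX X) ∈ γ)`. [cite: DuminilCopinHonglerNolin2011, §4, Lemma 12] -/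
theorem dartObs_qX_eq [Fintype (meshDomain E.Ω E.δ)] (hc₀ : DiscreteDobrushin.startCorner hE = c₀ L) (hLX : L < X)
    (hheight : ∀ v ∈ meshDomain E.Ω E.δ, v ∉ E.zdArcB → 0 ≤ v 1) (hB : (![X, -1] : Site 2) ∈ E.zdArcB)
    (hinner : E.IsInnerFace (cFace (qX X))) :
    dartObs E hE (qX X) = (((fkDobrushinMeasure E).real {ω | cSrc (qX X) ∈ fkInterface E ω} : ℝ) : ℂ) := by
  have hinst : (meshDomain_finite hE.isBounded hE.delta_pos).fintype = ‹Fintype (meshDomain E.Ω E.δ)› :=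
    Subsingleton.elim _ _
  rw [fkDobrushinMeasure_of_pos E hE.isBounded hE.delta_pos, hinst,
    DiscreteDobrushin.fkInterfaceMeasure_real_apply E criticalFKIsingParam_mem_Icc two_pos, Complex.ofReal_sum]
  unfold dartObs
  refine Finset.sum_congr rfl fun ω _ => ?_
  rw [Complex.ofReal_mul]
  congr 1
  -- the inner sum over the visits of the dart
  set ω' := liftConfig E.Ω E.δ ω with hω'
  set β := E.bcBondConfig ω' with hβ
  set N := DiscreteDobrushin.exitTime hE ω' with hN
  have hc : E.IsStartCorner (c₀ L) := hc₀ ▸ DiscreteDobrushin.isStartCorner_startCorner hE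
  rw [hc₀]
  set S := (Finset.range N).filter (fun j => cornerOrbit β (c₀ L) j = qX X) with hS
  -- every visit has phase one
  have hphase : ∀ j ∈ S, quarterPhase (turnCount β (c₀ L) j) = 1 := by
    intro j hj
    rw [hS, Finset.mem_filter, Finset.mem_range] at hj
    have hjN : j < DiscreteDobrushin.exitTime hE ω' := hj.1
    rcases turnCount_eq_zero_or_eight (hyp_of_domain hE hc₀ hLX hheight hB ω' hjN hj.2) with h | h
    · rw [h, quarterPhase_zero]
    · rw [h, quarterPhase_eight]
  -- two visits coincide (the orbit is injective before the exit)
  have hinj : ∀ i ∈ S, ∀ i' ∈ S, i = i' := by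
    intro i hi i' hi'
    rw [hS, Finset.mem_filter, Finset.mem_range] at hi hi'
    by_contra hne
    have hinnerk : ∀ k < max i i', E.IsInnerFace (cFace (cornerOrbit β (c₀ L) k)) := by
      intro k hk
      have := DiscreteDobrushin.isInnerFace_of_lt_exitTime hE ω' (k := k) (by
        have := lt_max_iff.1 hk; omega)
      rwa [hc₀] at this
    rcases Nat.lt_or_gt_of_ne hne with hlt | hlt
    · exact cornerOrbit_ne hE hc hlt (fun k hk => hinnerk k (by omega)) (hi.2.trans hi'.2.symm)
    · exact cornerOrbit_ne hE hc hlt (fun k hk => hinnerk k (by omega)) (hi'.2.trans hi.2.symm)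
  -- a passage through `cSrc qX` is a visit of `qX` before the exit
  have hpass : cSrc (qX X) ∈ fkInterface E ω' → ∃ i, i ∈ S := by
    intro h
    change cSrc (qX X) ∈ medialExploration E ω' at h
    rw [DiscreteDobrushin.medialExploration_eq_explorationList hE, hc₀, explorationList, List.mem_map] at h
    obtain ⟨i, hi, hiq⟩ := h
    rw [List.mem_range] at hi
    -- the vertex of the `i`-th corner is `(X, 0)`
    have hfst : (cornerOrbit β (c₀ L) i).1 = (qX X).1 := by
      have hmem : (cornerOrbit β (c₀ L) i).1 ∈ cSrc (qX X) := by
        rw [← hiq, cSrc]; exact Sym2.mem_mk_left _ _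
      rw [cSrc, Sym2.mem_iff] at hmem
      rcases hmem with h1 | h1
      · exact h1
      · exfalso
        refine cornerOrbit_fst_not_mem_zdArcB hE hc ω' i ?_
        rw [h1]
        convert hB using 1
        ext k; fin_cases k <;> simp [qX, cornerUnit]
    have horb : cornerOrbit β (c₀ L) i = qX X := eq_of_cSrc_eq_of_fst_eq hiq hfst
    -- not the exit corner: the face of `qX` is inner
    have hiN : i < N := by
      rcases Nat.lt_or_ge i N with h' | h'
      · exact h'
      · exfalso
        have hi' : i = N := by omega
        have hno := DiscreteDobrushin.not_isInnerFace_exitTime hE ω'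
        rw [hc₀, ← hN, ← hi', horb] at hno
        exact hno hinner
    exact ⟨i, by rw [hS, Finset.mem_filter, Finset.mem_range]; exact ⟨hiN, horb⟩⟩
  -- a visit of `qX` before the exit is a passage through `cSrc qX`
  have hvisit : ∀ i ∈ S, cSrc (qX X) ∈ fkInterface E ω' := by
    intro i hi
    rw [hS, Finset.mem_filter, Finset.mem_range] at hi
    change cSrc (qX X) ∈ medialExploration E ω'
    rw [DiscreteDobrushin.medialExploration_eq_explorationList hE, hc₀, explorationList, List.mem_map]
    exact ⟨i, List.mem_range.2 (by omega), by rw [hi.2]⟩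
  -- evaluate the inner sum
  by_cases hmem : cSrc (qX X) ∈ fkInterface E ω'
  · obtain ⟨i, hi⟩ := hpass hmem
    have hSi : S = {i} := Finset.eq_singleton_iff_unique_mem.2 ⟨hi, fun i' hi' => hinj i' hi' i hi⟩
    rw [if_pos (show ω' ∈ {ω | cSrc (qX X) ∈ fkInterface E ω} from hmem), hSi, Finset.sum_singleton, hphase i hi]
    push_cast
    rfl
  · have hS0 : S = ∅ := by
      rw [Finset.eq_empty_iff_forall_notMem]
      intro i hi
      exact hmem (hvisit i hi)
    rw [if_neg (show ω' ∉ {ω | cSrc (qX X) ∈ fkInterface E ω} from hmem), hS0, Finset.sum_empty]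
    push_cast
    rfl

include hE in
open scoped Classical in
/-- **`|F(e)|² = P(e ∈ γ)²` at a free-arc dart.** [cite: DuminilCopinHonglerNolin2011, §4, Lemma 12] -/
theorem dartFlux_qX_eq [Fintype (meshDomain E.Ω E.δ)] (hc₀ : DiscreteDobrushin.startCorner hE = c₀ L) (hLX : L < X)
    (hheight : ∀ v ∈ meshDomain E.Ω E.δ, v ∉ E.zdArcB → 0 ≤ v 1) (hB : (![X, -1] : Site 2) ∈ E.zdArcB)
    (hinner : E.IsInnerFace (cFace (qX X))) :
    dartFlux E hE (qX X) = ((fkDobrushinMeasure E).real {ω | cSrc (qX X) ∈ fkInterface E ω}) ^ 2 := by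
  rw [dartFlux, dartObs_qX_eq hE hc₀ hLX hheight hB hinner, Complex.norm_real, Real.norm_of_nonneg MeasureTheory.measureReal_nonneg]

end Observable

end FreeArcPhase

end Literature.Probability.LatticeModels

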